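import Summits.Ventures.LatticeQCDFlow.Scoring.SU2CharacterRowIntegral
import Summits.Ventures.LatticeQCDFlow.Scoring.SU2PlaquetteSeriesFubini
import Summits.Ventures.LatticeQCDFlow.Scoring.SU2ClassFunctionConvolution
import HarnessLib

/-!
# Venture YMGap, track Y3 FLOW-DATA — the SU(2) Wilson weight `e^{b a₀}` as a character series at EVERY
# group element, character series as test functions, and the ONE-LINK MERGING rule (theorems only)

HONEST FRAMING: venture file of the cell `pub-ymgap` (QuantumFields programme), track Y3; companion THEOREMS
preparing the d = 2 EQUALITY `E₁((ℤ/L)¹; β) = L·(−ln u(β))` for the typed tube objects of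
`FlowData/TorelonEnergy.lean` (file 1/3: pure `SU(2)` Haar calculus).  Finite Haar integrals over `SU(2)`; no
number, no row, nothing about limits or a mass gap.  NO Peter–Weyl: everything rests on the prior venture's
class-function calculus (`LatticeQCDFlow/Scoring`): the characters `χ_n = U_n(a₀)` are Haar-orthonormal, the
one-plaquette weight has the character series `e^{−β(2−2t)} = Σ_n e^{−2β}(I_n(2β) − I_{n+2}(2β)) U_n(t)` on all of
`[−1, 1]` with `Σ_n (n+1) c_n < ∞` (`SU2PlaquetteSeriesFubini`), and the face-merging rule
`∫ χ_m(AV) χ_n(V⁻¹B) dV = [m=n] χ_n(AB)/(n+1)` (`SU2ClassFunctionConvolution`).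

* `hasSum_besselISub_mul_su2Character` — in the cell's normalisation (`w = e^{J Re tr} = e^{b a₀}`, `b = 2J = β_W`):
  `e^{b a₀(X)} = Σ_n (I_n(b) − I_{n+2}(b)) χ_n(X)` at EVERY `X ∈ SU(2)` (`b ≥ 0`), `summable_succ_mul_besselISub`;
* `besselISub_div_succ_antitone` — the eigenvalue list `c_n(b)/(n+1) = 2I_{n+1}(b)/b` is antitone in `n`;
* `integral_characterSeries_mul` — a character series `Σ c_n χ_n(w(V))` with `Σ (n+1)|c_n| < ∞` integrates term
  by term against a bounded factor; `continuous_characterSeries`, `abs_characterSeries_le`;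
* **`integral_weight_mul_su2Character`** — ONE-LINK MERGING: `∫ e^{b a₀(P V⁻¹)} χ_n(V Q) dV = (c_n(b)/(n+1)) χ_n(P Q)`;

References: I. Montvay, G. Münster (1994) §3.2.6 [cite: MontvayMunster1994, §3.2.6]; DLMF §10.29.
-/

noncomputable section

open scoped BigOperators Topology
open MeasureTheory Filter Function Set Polynomial.Chebyshev
open Literature.MathematicalPhysics.QuantumFieldTheory Literature.MathematicalPhysics.QuantumLattice Literature.Analysis.FunctionSpaces
open Summit.Ventures.LatticeQCDFlow.Exactness Summit.Ventures.LatticeQCDFlow.Scoring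

namespace Summit.Ventures.YMGap.FlowData

/-! ### Book-keeping on `SU(2)`: cyclicity of `a₀`, the character bound -/

section Bookkeeping

/-- `|χ_n(X)| ≤ n + 1` on the group. [folklore] -/
theorem abs_su2Character_le (n : ℕ) (X : Matrix.specialUnitaryGroup (Fin 2) ℂ) :
    |(U ℝ n).eval (su2a0 X)| ≤ (n : ℝ) + 1 :=
  abs_chebyshevU_eval_le n (abs_su2a0_le_one X)

/-- The characters are continuous functions on the group. [folklore] -/
theorem continuous_su2Character (n : ℕ) :
    Continuous fun X : Matrix.specialUnitaryGroup (Fin 2) ℂ => (U ℝ n).eval (su2a0 X) :=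
  (U ℝ n).continuous.comp continuous_su2a0

/-- **`Σ_n (n+1) c_n(b) < ∞`** for the character coefficients `c_n(b) = I_n(b) − I_{n+2}(b)` of `e^{b a₀}`, `b ≥ 0`.
[folklore] -/
theorem summable_succ_mul_besselISub {b : ℝ} (hb : 0 ≤ b) :
    Summable fun n : ℕ => ((n : ℝ) + 1) * (besselI n b - besselI (n + 2) b) := by
  have h := (summable_succ_mul_charCoeff (β := b / 2) (by linarith)).mul_left (Real.exp (2 * (b / 2)))
  rw [show 2 * (b / 2) = b by ring] at h
  refine h.congr fun n => ?_
  rw [← mul_assoc, mul_comm (Real.exp b), mul_assoc, ← mul_assoc (Real.exp b), ← Real.exp_add, add_neg_cancel,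
    Real.exp_zero, one_mul]

/-- `c_n(b) ≥ 0` for `b ≥ 0`. [folklore] -/
theorem besselISub_nonneg {b : ℝ} (hb : 0 ≤ b) (n : ℕ) : 0 ≤ besselI n b - besselI (n + 2) b :=
  sub_nonneg.2 (besselI_antitone hb (by omega))

/-- `c_n(b)/(n+1) = 2 I_{n+1}(b)/b` (`b ≠ 0`). [cite: DLMF, 10.29.1] -/
theorem besselISub_div_succ {b : ℝ} (hb : b ≠ 0) (n : ℕ) :
    (besselI n b - besselI (n + 2) b) / (n + 1) = 2 * besselI (n + 1) b / b := by
  have h := mul_besselI_sub_besselI_add_two n b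
  have hn : ((n : ℝ) + 1) ≠ 0 := by positivity
  field_simp
  linarith [h]

/-- **Bessel order monotonicity on the eigenvalue list**: `c_n(b)/(n+1)` is antitone in `n` (`b > 0`).
[cite: DLMF, 10.37] -/
theorem besselISub_div_succ_antitone {b : ℝ} (hb : 0 < b) :
    Antitone fun n : ℕ => (besselI n b - besselI (n + 2) b) / (n + 1) := by
  intro m n hmn
  dsimp only
  rw [besselISub_div_succ hb.ne', besselISub_div_succ hb.ne']
  exact div_le_div_of_nonneg_right (mul_le_mul_of_nonneg_left (besselI_antitone hb.le (by omega)) zero_le_two)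
    hb.le

end Bookkeeping

/-! ### The character series of the Wilson weight at EVERY group element -/

section Expansion

/-- **The character series of the Wilson weight holds on all of `[−1, 1]`**: for `b ≥ 0` and `|t| ≤ 1`,
`Σ_n (I_n(b) − I_{n+2}(b)) U_n(t) = e^{bt}` (the prior venture's `hasSum_charCoeff_mul_chebyshevU_all` at `β = b/2`,
the normalisation `e^{−2β}` removed). [folklore] -/
theorem hasSum_besselISub_mul_chebyshevU {b : ℝ} (hb : 0 ≤ b) {t : ℝ} (ht : |t| ≤ 1) :
    HasSum (fun n : ℕ => (besselI n b - besselI (n + 2) b) * (U ℝ n).eval t) (Real.exp (b * t)) := by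
  have h := (hasSum_charCoeff_mul_chebyshevU_all (β := b / 2) (by linarith) (abs_le.1 ht)).mul_left (Real.exp b)
  rw [show 2 * (b / 2) = b by ring, ← Real.exp_add, show b + -(b / 2 * (2 - 2 * t)) = b * t by ring] at h
  refine h.congr_fun fun n => ?_
  rw [← mul_assoc, ← mul_assoc, ← Real.exp_add, add_neg_cancel, Real.exp_zero, one_mul]

/-- **The Wilson weight of `SU(2)` is its character series at EVERY group element**:
`e^{b a₀(X)} = Σ_n (I_n(b) − I_{n+2}(b)) χ_n(X)`, `b ≥ 0`. [cite: MontvayMunster1994, §3.2.6] -/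
theorem hasSum_besselISub_mul_su2Character {b : ℝ} (hb : 0 ≤ b) (X : Matrix.specialUnitaryGroup (Fin 2) ℂ) :
    HasSum (fun n : ℕ => (besselI n b - besselI (n + 2) b) * (U ℝ n).eval (su2a0 X)) (Real.exp (b * su2a0 X)) :=
  hasSum_besselISub_mul_chebyshevU hb (abs_su2a0_le_one X)

end Expansion

/-! ### One-link merging: `∫ w(P V⁻¹) χ_n(V Q) dV = (c_n/(n+1)) χ_n(PQ)` -/

section Merging

/-- Termwise integrability and the summable norm bound for a character series against a bounded factor.
[folklore] -/
theorem summable_integral_norm_characterSeries {c : ℕ → ℝ} (hc : Summable fun n : ℕ => ((n : ℝ) + 1) * |c n|)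
    {g : ℕ → Matrix.specialUnitaryGroup (Fin 2) ℂ → ℝ} {C : ℝ} (hg : ∀ n V, |g n V| ≤ C)
    (hgm : ∀ n, AEStronglyMeasurable (g n) (haarProbability (Matrix.specialUnitaryGroup (Fin 2) ℂ)))
    (w : Matrix.specialUnitaryGroup (Fin 2) ℂ → Matrix.specialUnitaryGroup (Fin 2) ℂ) (hw : Continuous w) :
    (∀ n, Integrable (fun V => c n * (U ℝ n).eval (su2a0 (w V)) * g n V)
        (haarProbability (Matrix.specialUnitaryGroup (Fin 2) ℂ))) ∧
      Summable fun n : ℕ => ∫ V, ‖c n * (U ℝ n).eval (su2a0 (w V)) * g n V‖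
        ∂haarProbability (Matrix.specialUnitaryGroup (Fin 2) ℂ) := by
  have hC : 0 ≤ C := (abs_nonneg _).trans (hg 0 1)
  have hbound : ∀ n V, ‖c n * (U ℝ n).eval (su2a0 (w V)) * g n V‖ ≤ ((n : ℝ) + 1) * |c n| * C := by
    intro n V
    rw [Real.norm_eq_abs, abs_mul, abs_mul]
    calc |c n| * |(U ℝ n).eval (su2a0 (w V))| * |g n V| ≤ |c n| * ((n : ℝ) + 1) * C :=
          mul_le_mul (mul_le_mul_of_nonneg_left (abs_su2Character_le n (w V)) (abs_nonneg _)) (hg n V)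
            (abs_nonneg _) (by positivity)
      _ = ((n : ℝ) + 1) * |c n| * C := by ring
  have hint : ∀ n, Integrable (fun V => c n * (U ℝ n).eval (su2a0 (w V)) * g n V)
      (haarProbability (Matrix.specialUnitaryGroup (Fin 2) ℂ)) := fun n =>
    Integrable.of_bound ((continuous_const.mul ((continuous_su2Character n).comp hw)).aestronglyMeasurable.mul
      (hgm n)) _ (Eventually.of_forall (hbound n))
  refine ⟨hint, Summable.of_nonneg_of_le (fun n => integral_nonneg fun V => norm_nonneg _) (fun n => ?_)
    (hc.mul_right C)⟩
  calc ∫ V, ‖c n * (U ℝ n).eval (su2a0 (w V)) * g n V‖ ∂haarProbability (Matrix.specialUnitaryGroup (Fin 2) ℂ)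
      ≤ ∫ _V, ((n : ℝ) + 1) * |c n| * C ∂haarProbability (Matrix.specialUnitaryGroup (Fin 2) ℂ) :=
        integral_mono_of_nonneg (Eventually.of_forall fun V => norm_nonneg _) (integrable_const _)
          (Eventually.of_forall (hbound n))
    _ = ((n : ℝ) + 1) * |c n| * C := by rw [integral_const, probReal_univ, one_smul]

/-- **Integrating a character series against a bounded factor term by term.** [folklore] -/
theorem integral_characterSeries_mul {c : ℕ → ℝ} (hc : Summable fun n : ℕ => ((n : ℝ) + 1) * |c n|)
    {g : Matrix.specialUnitaryGroup (Fin 2) ℂ → ℝ} {C : ℝ} (hg : ∀ V, |g V| ≤ C)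
    (hgm : AEStronglyMeasurable g (haarProbability (Matrix.specialUnitaryGroup (Fin 2) ℂ)))
    (w : Matrix.specialUnitaryGroup (Fin 2) ℂ → Matrix.specialUnitaryGroup (Fin 2) ℂ) (hw : Continuous w) :
    ∫ V, (∑' n : ℕ, c n * (U ℝ n).eval (su2a0 (w V))) * g V ∂haarProbability (Matrix.specialUnitaryGroup (Fin 2) ℂ) =
      ∑' n : ℕ, c n * ∫ V, (U ℝ n).eval (su2a0 (w V)) * g V ∂haarProbability (Matrix.specialUnitaryGroup (Fin 2) ℂ) := by
  obtain ⟨hint, hsum⟩ := summable_integral_norm_characterSeries hc (g := fun _ => g) (fun _ V => hg V) (fun _ => hgm) w hw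
  have hpt : ∀ V, Summable fun n : ℕ => c n * (U ℝ n).eval (su2a0 (w V)) := fun V => by
    refine Summable.of_norm_bounded hc fun n => ?_
    rw [Real.norm_eq_abs, abs_mul, mul_comm]
    exact mul_le_mul_of_nonneg_right (abs_su2Character_le n (w V)) (abs_nonneg _)
  calc ∫ V, (∑' n : ℕ, c n * (U ℝ n).eval (su2a0 (w V))) * g V ∂haarProbability (Matrix.specialUnitaryGroup (Fin 2) ℂ)
      = ∫ V, ∑' n : ℕ, c n * (U ℝ n).eval (su2a0 (w V)) * g V ∂haarProbability (Matrix.specialUnitaryGroup (Fin 2) ℂ) := by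
        refine integral_congr_ae (Eventually.of_forall fun V => ?_)
        dsimp only
        rw [← tsum_mul_right]
    _ = ∑' n : ℕ, ∫ V, c n * (U ℝ n).eval (su2a0 (w V)) * g V ∂haarProbability (Matrix.specialUnitaryGroup (Fin 2) ℂ) :=
        (integral_tsum_of_summable_integral_norm hint hsum).symm
    _ = ∑' n : ℕ, c n * ∫ V, (U ℝ n).eval (su2a0 (w V)) * g V ∂haarProbability (Matrix.specialUnitaryGroup (Fin 2) ℂ) := by
        refine tsum_congr fun n => ?_
        rw [← integral_const_mul]
        refine integral_congr_ae (Eventually.of_forall fun V => ?_)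
        ring

/-- The face-merging rule with the first link inverted: `∫ χ_k(P V⁻¹) χ_n(V Q) dV = [k = n] χ_n(PQ)/(n+1)`
(inversion invariance of the Haar measure). [folklore] -/
theorem integral_su2Character_inv_mul_conv (P Q : Matrix.specialUnitaryGroup (Fin 2) ℂ) (k n : ℕ) :
    ∫ V, (U ℝ k).eval (su2a0 (P * V⁻¹)) * (U ℝ n).eval (su2a0 (V * Q))
        ∂haarProbability (Matrix.specialUnitaryGroup (Fin 2) ℂ) =
      if k = n then (U ℝ n).eval (su2a0 (P * Q)) / (n + 1) else 0 := by
  rw [← integral_inv_eq_self (fun V : Matrix.specialUnitaryGroup (Fin 2) ℂ =>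
    (U ℝ k).eval (su2a0 (P * V⁻¹)) * (U ℝ n).eval (su2a0 (V * Q))) (haarProbability _)]
  simp only [inv_inv]
  exact integral_su2Character_mul_conv P Q k n

/-- **ONE-LINK MERGING**: `∫ e^{b a₀(P V⁻¹)} χ_n(V Q) dV = (c_n(b)/(n+1)) χ_n(P Q)` for `b ≥ 0` — expand the weight in
characters (everywhere), integrate term by term, merge faces. [cite: MontvayMunster1994, §3.2.6] -/
theorem integral_weight_mul_su2Character {b : ℝ} (hb : 0 ≤ b) (n : ℕ) (P Q : Matrix.specialUnitaryGroup (Fin 2) ℂ) :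
    ∫ V, Real.exp (b * su2a0 (P * V⁻¹)) * (U ℝ n).eval (su2a0 (V * Q))
        ∂haarProbability (Matrix.specialUnitaryGroup (Fin 2) ℂ) =
      (besselI n b - besselI (n + 2) b) / (n + 1) * (U ℝ n).eval (su2a0 (P * Q)) := by
  have hexp : ∀ V : Matrix.specialUnitaryGroup (Fin 2) ℂ, Real.exp (b * su2a0 (P * V⁻¹)) =
      ∑' k : ℕ, (besselI k b - besselI (k + 2) b) * (U ℝ k).eval (su2a0 (P * V⁻¹)) := fun V =>
    (hasSum_besselISub_mul_su2Character hb (P * V⁻¹)).tsum_eq.symm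
  simp_rw [hexp]
  have hc : Summable fun k : ℕ => ((k : ℝ) + 1) * |besselI k b - besselI (k + 2) b| :=
    (summable_succ_mul_besselISub hb).congr fun k => by rw [abs_of_nonneg (besselISub_nonneg hb k)]
  rw [integral_characterSeries_mul hc (g := fun V => (U ℝ n).eval (su2a0 (V * Q))) (C := (n : ℝ) + 1)
    (fun V => abs_su2Character_le n (V * Q)) ((continuous_su2Character n).comp (continuous_id.mul
      continuous_const)).aestronglyMeasurable (fun V => P * V⁻¹) (continuous_const.mul continuous_inv)]
  simp_rw [integral_su2Character_inv_mul_conv P Q]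
  rw [tsum_eq_single n (fun k hk => by rw [if_neg hk, mul_zero]), if_pos rfl]
  ring

end Merging

/-! ### Character series as continuous functions -/

section Series

/-- A character series with `Σ (n+1)|c_n| < ∞` is a continuous function on the group. [folklore] -/
theorem continuous_characterSeries {c : ℕ → ℝ} (hc : Summable fun n : ℕ => ((n : ℝ) + 1) * |c n|) :
    Continuous fun X : Matrix.specialUnitaryGroup (Fin 2) ℂ => ∑' n : ℕ, c n * (U ℝ n).eval (su2a0 X) := by
  refine continuous_tsum (fun n => continuous_const.mul (continuous_su2Character n)) hc fun n X => ?_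
  rw [Real.norm_eq_abs, abs_mul, mul_comm]
  exact mul_le_mul_of_nonneg_right (abs_su2Character_le n X) (abs_nonneg _)

/-- A character series with `Σ (n+1)|c_n| < ∞` is bounded by that sum. [folklore] -/
theorem abs_characterSeries_le {c : ℕ → ℝ} (hc : Summable fun n : ℕ => ((n : ℝ) + 1) * |c n|)
    (X : Matrix.specialUnitaryGroup (Fin 2) ℂ) :
    |∑' n : ℕ, c n * (U ℝ n).eval (su2a0 X)| ≤ ∑' n : ℕ, ((n : ℝ) + 1) * |c n| := by
  have hb : ∀ n, ‖c n * (U ℝ n).eval (su2a0 X)‖ ≤ ((n : ℝ) + 1) * |c n| := fun n => by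
    rw [Real.norm_eq_abs, abs_mul, mul_comm]
    exact mul_le_mul_of_nonneg_right (abs_su2Character_le n X) (abs_nonneg _)
  rw [← Real.norm_eq_abs]
  exact tsum_of_norm_bounded hc.hasSum hb

/-- A character series is central: its value on `PQ` equals its value on `QP`. [folklore] -/
theorem characterSeries_mul_comm (c : ℕ → ℝ) (P Q : Matrix.specialUnitaryGroup (Fin 2) ℂ) :
    ∑' n : ℕ, c n * (U ℝ n).eval (su2a0 (P * Q)) = ∑' n : ℕ, c n * (U ℝ n).eval (su2a0 (Q * P)) := by
  simp_rw [su2a0_mul_comm P Q]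

end Series

end Summit.Ventures.YMGap.FlowData
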